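import Mathlib
import HarnessLib

/-!
# ThreeClassNumberOneDensity

Topic `Literature/NumberTheory/QuadraticFields`. Named literature fact(s) relocated by the gate from `Summits/BirchSwinnertonDyer/BirchSwinnertonDyer/Theorems/EisensteinPrimesMazurMCOnCellBTwistbackKLFieldSupply.lean`
(accept-time relocation of `[cite]`d propositions written inline in a Summits proposal; human ruling 2026-08-15).
Sources: KrizLi2019, NakagawaHorie1988.

* `Literature.NumberTheory.QuadraticFields.nakagawaHorie_taya_exists_imaginary_h3_eq_one`
-/

namespace Literature.NumberTheory.QuadraticFields

open scoped Classical
open NumberField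

/-- **Nakagawa–Horie 1988, Thm. 1, with Taya 2000 (as Kriz–Li, Forum Math. Sigma 7 (2019) e15, Def. 9.1,
Thm. 9.2, Prop. 9.3 = arXiv:1609.06687 Def. 4.1, Thm. 4.2, Prop. 4.3): `3`-class-number-one imaginary quadratic
fields in a prescribed residue class, EXISTENCE FORM.** Printed: "We say that positive integers `m` and `M`
comprise a *valid pair* `(m, M)` if both of the following properties hold: (1) if `ℓ` is an odd prime number
dividing `(m, M)`, then `ℓ²` divides `M` but not `m`, and (2) if `M` is even, then (a) `4 ∣ M` and
`m ≡ 1 (mod 4)`, or (b) `16 ∣ M` and `m ≡ 8` or `12 (mod 16)`." (Def. 9.1); `K⁻(x, m, M)` = the imaginary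
quadratic fields `k` with fundamental discriminant `|d_k| < x`, `d_k ≡ m (mod M)`; `h₃(d)` = the `3`-primary part
of the class number of `ℚ(√d)`; Thm. 9.2 [Nakagawa–Horie]: `|K⁻(x,m,M)| ∼ (3x/(π²Φ(M))) ∏_{ℓ∣M} q/(ℓ+1)` and,
for a valid pair, `∑_{k ∈ K⁻(x,m,M)} h₃(d_k) ∼ 2|K⁻(x,m,M)|`; Prop. 9.3 [Taya]: for a valid pair
`lim |K⁻_*(x,m,M)| / |K⁻(x,1,1)| ≥ (1/(2Φ(M))) ∏_{ℓ∣M} q/(ℓ+1)`, `K⁻_* = {k ∈ K⁻ : h₃(d_k) = 1}`; "In particular,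
the set of … imaginary quadratic fields `k` such that `d_k ≡ m (mod M)` and `h₃(d_k) = 1` has positive density
in the set of all … imaginary quadratic fields." TRANSCRIBED in EXISTENCE form (weaker than the printed positive
density, which makes the set infinite, hence unbounded in `|d_k|`): for every valid pair `(m, M)` and every bound
`X` there is a fundamental discriminant `δ < −X` (the tree's spelled-out disjunction of
`QuadraticFields/FundamentalDiscriminant.lean`; the imaginary quadratic fields are exactly the `ℚ(√δ)`, `δ < 0`
fundamental, `exists_numberField_discr_eq` / `isFundamentalDiscriminant_discr`) with `δ ≡ m (mod M)` and
`h₃(δ) = 1`, the latter spelled out as "`3 ∤ h_F` for every quadratic number field `F` in which `δ` is a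
square" — VERBATIM the body of the tree's `Literature.NumberTheory.EllipticCurves.KrizLi2019.ThreeClassNumberTrivial δ`
(the rendering of Kriz–Li's `h₃(D) = 1` used by `thm94_exists_heegnerField_h3_eq_one`; for `δ` fundamental these
`F` are the copies of `ℚ(√δ)`), so that this quadratic-fields fact imports nothing about elliptic curves. The
real-quadratic half (`K⁺`, density `≥ 5/(6Φ(M))·∏`) is not transcribed. -- TODO(general form): the asymptotic
densities of Thm. 9.2 / Prop. 9.3 and the real-quadratic case. Named fact (PUBLISHED, refereed: Proc. AMS ×2,
transcribed through Kriz–Li's restatement); nothing asserted; users take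
`(h : nakagawaHorie_taya_exists_imaginary_h3_eq_one)`.
[cite: NakagawaHorie1988, Thm. 1] [cite: KrizLi2019, Def. 9.1, Thm. 9.2, Prop. 9.3 (§9) = arXiv:1609.06687 Def. 4.1, Thm. 4.2, Prop. 4.3 ("In particular … positive density")]
[file NumberTheory/QuadraticFields/ThreeClassNumberOneDensity] -/
def nakagawaHorie_taya_exists_imaginary_h3_eq_one : Prop :=
  ∀ (m M : ℕ), 0 < m → 0 < M →
    -- `(m, M)` is a valid pair (Def. 9.1): (1) odd primes dividing `(m, M)`
    (∀ ℓ : ℕ, ℓ.Prime → ℓ ≠ 2 → ℓ ∣ m → ℓ ∣ M → ℓ ^ 2 ∣ M ∧ ¬ ℓ ^ 2 ∣ m) →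
    -- (2) `M` even
    (2 ∣ M → (4 ∣ M ∧ m % 4 = 1) ∨ (16 ∣ M ∧ (m % 16 = 8 ∨ m % 16 = 12))) →
    ∀ X : ℕ, ∃ δ : ℤ, δ < -(X : ℤ) ∧
      -- `δ` is a fundamental discriminant (`= d_k` of the imaginary quadratic field `k = ℚ(√δ)`)
      ((δ % 4 = 1 ∧ Squarefree δ ∧ δ ≠ 1) ∨
        (4 ∣ δ ∧ (δ / 4 % 4 = 2 ∨ δ / 4 % 4 = 3) ∧ Squarefree (δ / 4))) ∧
      -- `d_k ≡ m (mod M)`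
      δ ≡ (m : ℤ) [ZMOD (M : ℤ)] ∧
      -- `h₃(d_k) = 1`: `3 ∤ h_F` for every quadratic field `F ∋ √δ` (VERBATIM the body of the tree's
      -- `KrizLi2019.ThreeClassNumberTrivial δ`, spelled out so that this fact needs no elliptic-curve import)
      (∀ (F : Type) [Field F] [NumberField F],
        Module.finrank ℚ F = 2 → (∃ x : F, x ^ 2 = (δ : F)) → ¬ 3 ∣ NumberField.classNumber F)

end Literature.NumberTheory.QuadraticFields
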